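import Mathlib.Geometry.Manifold.Instances.Sphere
import Mathlib.Geometry.Manifold.Diffeomorph
import Mathlib.Topology.Homotopy.Equiv
import Literature.Topology.FourManifolds.Trisections
import Literature.Topology.FourManifolds.ClosedBall
import HarnessLib

/-!
# Weakly reducible trisections; weakly reducible genus-three trisections are standard (AZ 2025)

Topic `Literature/Topology/FourManifolds`, after `Trisections.lean` (the tree's corrected
Gay–Kirby predicate `Literature.Topology.FourManifolds.IsGKTrisection X g k S`: three sectors
`S 0, S 1, S 2 ⊆ X`, pairwise intersections genus-`g` handlebodies, triple intersection the
central surface) and `ClosedBall.lean` (the closed unit disc `𝔻²` as a manifold with boundary,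
model `𝓡∂ 2`).

## What is printed

Aranda–Zupan, *Manifolds with weakly reducible genus-three trisections are standard*
(arXiv:2503.04607, 2025):

* §2, p. 6 (with §1, p. 2): "a trisection is said to be *reducible* if there exists a curve `c`
  in `Σ` which is a compressing curve for all three of `H_α`, `H_β`, and `H_γ`"; "We say that `T`
  is *weakly reducible* if there exist non-separating curves `c` and `c′` in `Σ` such that `c` is
  a compressing curve for `H_α` and `c′` is a compressing curve for both `H_β` and `H_γ`" (p. 2:
  "disjoint non-separating curves `c` and `c′`"; Remark 2.5 on why non-separating is required).
  Conventions (§2, p. 3): all manifolds smooth and orientable; a *curve* in `Σ` is (the class of)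
  an essential simple closed curve; a *compressing disk* for a handlebody `H` is a properly
  embedded disk `D ⊂ H` with `∂D` a curve in `Σ = ∂H`.
* Theorem 1.3 (p. 2): "Suppose `X` admits a weakly reducible genus-three trisection `T`. Then
  either `T` is reducible, or `T` contains a five-chain. In particular, `X` is diffeomorphic to a
  spun lens space `S_p` or its sibling `S′_p`, `S⁴`, or a connected sum of copies of `±ℂP²`,
  `S¹ × S³`, and `S² × S²`."

## How it is rendered here (relative to the tree's notions, D-0014)

For sectors `S : Fin 3 → Set X` of a smooth 4-manifold `X` (charted on `ℝ⁴`):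

* `Trisection.centralSurfaceSet S = ⋂ l, S l` (`Σ`, as a set; the topic's subtype
  `centralSurface S` of `TrisectionFunctor.lean` is `↥(centralSurfaceSet S)`) and
  `Trisection.spineHandlebody S p = ⋂ l ≠ p, S l = S (p+1) ∩ S (p+2)` (the handlebody
  `H_p` of the spine; `spineHandlebody_eq_inter` links it to the subtype `handlebodyOpp S p`);
* `Trisection.IsCurve S c` — `c ⊆ Σ` is the image of a smooth embedding `S¹ → X`;
  `Trisection.BoundsDisc S A c` — `c` bounds a *properly* embedded smooth disc in `A`: a smooth
  embedding `d : 𝔻² → X` with image in `A`, `d(∂𝔻²) = c` and `d(𝔻²) ∩ Σ = c` (a compressing disc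
  of `H_p` when `A = H_p`); `Trisection.IsNonSeparating S c` — `Σ ∖ c` is connected;
* `Trisection.IsWeaklyReducible S` — the printed definition with the disjointness of p. 2 made
  explicit (a STRONGER hypothesis, so every fact below is at most weakened): some `c` compresses
  in one handlebody `H_p` and a disjoint `c′` in the other two, both non-separating in `Σ`;
  `Trisection.IsReducible S` — an essential curve (bounding no disc inside `Σ`) compressing in all
  three handlebodies.  `Trisection.isWeaklyReducible_iff` / `isReducible_iff` display the fully
  inlined formulas (the shape used verbatim by route statements over `IsGKTrisection`).
* `arandaZupan_genus_three_weaklyReducible_homotopySphere_gk` — NAMED FACT, the homotopy-sphere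
  COROLLARY of Thm. 1.3 over `IsGKTrisection X 3 k S`: among `S_p`, `S′_p` (`π₁ = ℤ/p`; both `S⁴`
  for `p = ±1`, §2 p. 7), `S⁴` and the connected sums of `±ℂP²`, `S¹ × S³`, `S² × S²` (non-trivial
  `π₁` or `H₂` unless the sum is empty) the only homotopy 4-sphere is `S⁴`, so a closed connected
  oriented smooth `X ≃ₕ S⁴` with a weakly reducible genus-`3` trisection is diffeomorphic to `S⁴`.
  Conclusion weakened to
  "`≅ S⁴`" exactly as for the genus-`≤ 2` facts
  `Literature.Barriers.SmoothPoincare4.mz_genus_le_two_homotopySphere_gk` /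
  `msz_homotopySphere_gk` (`Barriers/SmoothPoincare4/LowGenusTrisectionsStandard.lean`), whose
  shape (explicit `SmoothOrientation`, `[CompactSpace] [ConnectedSpace]`, `X ≃ₕ 𝕊⁴ →
  Nonempty (X ≃ₘ 𝕊⁴)`) it copies; the first dichotomy ("reducible or five-chain") and the full
  diffeomorphism list are not rendered (no spun-lens-space / five-chain vocabulary in the tree).
  Users take `(h : arandaZupan_genus_three_weaklyReducible_homotopySphere_gk)`.

Nothing here is proved except the two `iff`-by-`rfl` unfoldings and the symmetry of the
vocabulary under relabelling of the sectors that is definitionally free (`spineHandlebody`,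
`centralSurfaceSet` do not depend on an order of intersection).

## References

* R. Aranda, A. Zupan, *Manifolds with weakly reducible genus-three trisections are standard*,
  arXiv:2503.04607 (2025), Thm. 1.3 (p. 2), §2 (pp. 3, 6), Remark 2.5. [ArandaZupan2025]
* D. Gay, R. Kirby, *Trisecting 4-manifolds*, Geom. Topol. 20 (2016), Def. 1. [GayKirby2016]
* J. Meier, A. Zupan, *Genus-two trisections are standard*, Geom. Topol. 21 (2017). [MeierZupan2017]
-/

noncomputable section

open scoped Manifold ContDiff Topology
open Set ContinuousMap

namespace Literature.Topology.FourManifolds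

universe u

/-- Local notation: `𝔼 n` is the model Euclidean space `EuclideanSpace ℝ (Fin n)`. -/
local notation "𝔼 " n:arg => EuclideanSpace ℝ (Fin n)

/-- Local notation: `𝕊 n` is the unit sphere in `EuclideanSpace ℝ (Fin (n + 1))`. -/
local notation "𝕊 " n:arg => (Metric.sphere (0 : EuclideanSpace ℝ (Fin (n + 1))) 1)

/-- Local notation: `𝔻 n` is the closed unit ball in `EuclideanSpace ℝ (Fin n)` (a manifold with
boundary, `ClosedBall.lean`). -/
local notation "𝔻 " n:arg => (Metric.closedBall (0 : EuclideanSpace ℝ (Fin n)) 1)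

namespace Trisection

variable {X : Type u}

/-! #### Set-level vocabulary (no topology needed) -/

/-- The **central surface** `Σ = S 0 ∩ S 1 ∩ S 2` of three sectors, as a SET (the subtype
`Literature.Topology.FourManifolds.centralSurface S = ↥(⋂ l, S l)` of `TrisectionFunctor.lean` is
its coercion to a type; `centralSurfaceSet_eq`). [cite: GayKirby2016, Def. 1] -/
def centralSurfaceSet (S : Fin 3 → Set X) : Set X :=
  ⋂ l, S l

/-- `centralSurfaceSet S` is literally `⋂ l, S l` (so `centralSurface S = ↥(centralSurfaceSet S)`
for the subtype of `TrisectionFunctor.lean`, by `rfl`). [folklore] -/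
theorem centralSurfaceSet_eq (S : Fin 3 → Set X) : centralSurfaceSet S = ⋂ l, S l :=
  rfl

/-- The **handlebody of the spine opposite the sector `p`**: `H_p = ⋂ l ≠ p, S l = S i ∩ S j`
(`{i, j, p} = {0, 1, 2}`); for a trisection a genus-`g` handlebody with `∂H_p = Σ`.
[cite: GayKirby2016, Def. 1] -/
def spineHandlebody (S : Fin 3 → Set X) (p : Fin 3) : Set X :=
  ⋂ (l : Fin 3) (_ : l ≠ p), S l

/-- The handlebody opposite `p` is `S (p+1) ∩ S (p+2)` — the set underlying the subtype
`Literature.Topology.FourManifolds.handlebodyOpp S p` of `TrisectionFunctor.lean`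
(so `handlebodyOpp S p = ↥(spineHandlebody S p)` after rewriting with this lemma). [folklore] -/
theorem spineHandlebody_eq_inter (S : Fin 3 → Set X) (p : Fin 3) :
    spineHandlebody S p = S (p + 1) ∩ S (p + 2) := by
  ext x
  simp only [spineHandlebody, mem_iInter, mem_inter_iff]
  fin_cases p <;> simp [Fin.forall_fin_succ]
  exact And.comm

/-- The central surface lies in every handlebody of the spine. [folklore] -/
theorem centralSurfaceSet_subset_spineHandlebody (S : Fin 3 → Set X) (p : Fin 3) :
    centralSurfaceSet S ⊆ spineHandlebody S p :=
  fun _ hx => mem_iInter₂.2 fun l _ => mem_iInter.1 hx l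

/-- The handlebody opposite `p` lies in the two other sectors. [folklore] -/
theorem spineHandlebody_subset (S : Fin 3 → Set X) {p l : Fin 3} (h : l ≠ p) :
    spineHandlebody S p ⊆ S l :=
  fun _ hx => (mem_iInter₂.1 hx) l h

/-! #### Curves, compressing discs, weak reducibility (smooth vocabulary) -/

variable [TopologicalSpace X]

/-- A curve `c` is **non-separating** on the central surface: `Σ ∖ c` is connected.
[cite: ArandaZupan2025, §2 (p. 6) and Remark 2.5] -/
def IsNonSeparating (S : Fin 3 → Set X) (c : Set X) : Prop :=
  IsConnected (centralSurfaceSet S \ c)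

variable [ChartedSpace (𝔼 4) X]

/-- A **curve** on the central surface: a subset `c ⊆ Σ` which is the image of a smooth embedding
of the circle `S¹ ⊂ ℝ²` into `X`. (Aranda–Zupan work with essential curves up to free homotopy;
here a curve is a concrete embedded circle, essentiality being imposed separately where needed.)
[cite: ArandaZupan2025, §2 (p. 3)] -/
def IsCurve (S : Fin 3 → Set X) (c : Set X) : Prop :=
  c ⊆ centralSurfaceSet S ∧
    ∃ γ : 𝕊 1 → X, Manifold.IsSmoothEmbedding (𝓡 1) (𝓡 4) ∞ γ ∧ range γ = c

/-- **`c` bounds a properly embedded disc in `A`** (relative to the central surface `Σ`): there is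
a smooth embedding `d` of the closed unit disc `𝔻²` into `X` with image in `A`, boundary circle
mapped onto `c`, and `d(𝔻²) ∩ Σ = c` (the interior misses `Σ`).  For `A = H_p` this says that
`c` is a *compressing curve* of the handlebody `H_p`. [cite: ArandaZupan2025, §2 (p. 3)] -/
def BoundsDisc (S : Fin 3 → Set X) (A c : Set X) : Prop :=
  ∃ d : 𝔻 2 → X, Manifold.IsSmoothEmbedding (𝓡∂ 2) (𝓡 4) ∞ d ∧ range d ⊆ A ∧
    d '' (𝓡∂ 2).boundary (𝔻 2) = c ∧ range d ∩ centralSurfaceSet S = c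

/-- **Weakly reducible** sectors (Aranda–Zupan): there are DISJOINT non-separating curves `c`,
`c′` on `Σ` such that `c` bounds a compressing disc in one handlebody `H_p` of the spine and `c′`
bounds compressing discs in the other two.  (Printed, p. 6: "non-separating curves `c` and `c′`
in `Σ` such that `c` is a compressing curve for `H_α` and `c′` is a compressing curve for both
`H_β` and `H_γ`"; p. 2: "disjoint non-separating curves"; the disjointness is made explicit here.)
[cite: ArandaZupan2025, §2 (p. 6), §1 (p. 2)] -/
def IsWeaklyReducible (S : Fin 3 → Set X) : Prop :=
  ∃ (p : Fin 3) (c c' : Set X), IsCurve S c ∧ IsCurve S c' ∧ Disjoint c c' ∧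
    IsNonSeparating S c ∧ IsNonSeparating S c' ∧ BoundsDisc S (spineHandlebody S p) c ∧
    ∀ q : Fin 3, q ≠ p → BoundsDisc S (spineHandlebody S q) c'

/-- **Reducible** sectors: there is an ESSENTIAL curve `δ` on `Σ` (one bounding no embedded disc
inside `Σ`) which bounds a compressing disc in each of the three handlebodies of the spine (a
*reducing curve*). [cite: ArandaZupan2025, §2 (p. 6)] -/
def IsReducible (S : Fin 3 → Set X) : Prop :=
  ∃ δ : Set X, IsCurve S δ ∧
    ¬ (∃ e : 𝔻 2 → X, Manifold.IsSmoothEmbedding (𝓡∂ 2) (𝓡 4) ∞ e ∧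
        range e ⊆ centralSurfaceSet S ∧ e '' (𝓡∂ 2).boundary (𝔻 2) = δ) ∧
    ∀ q : Fin 3, BoundsDisc S (spineHandlebody S q) δ

/-- `IsWeaklyReducible` fully inlined (by `rfl`): the shape in which route statements over
`IsGKTrisection` spell weak reducibility with `let`-bound `F`, `H`, `IsCurve`, `BoundsDisc`,
`NonSep`. [cite: ArandaZupan2025, §2 (p. 6)] -/
theorem isWeaklyReducible_iff (S : Fin 3 → Set X) :
    IsWeaklyReducible S ↔
      (let F : Set X := ⋂ l, S l
      let H : Fin 3 → Set X := fun p => ⋂ (l : Fin 3) (_ : l ≠ p), S l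
      let IsCurve : Set X → Prop := fun c => c ⊆ F ∧
        ∃ γ : 𝕊 1 → X, Manifold.IsSmoothEmbedding (𝓡 1) (𝓡 4) ∞ γ ∧ range γ = c
      let BoundsDisc : Set X → Set X → Prop := fun A c =>
        ∃ d : 𝔻 2 → X, Manifold.IsSmoothEmbedding (𝓡∂ 2) (𝓡 4) ∞ d ∧ range d ⊆ A ∧
          d '' (𝓡∂ 2).boundary (𝔻 2) = c ∧ range d ∩ F = c
      let NonSep : Set X → Prop := fun c => IsConnected (F \ c)
      ∃ (p : Fin 3) (c c' : Set X), IsCurve c ∧ IsCurve c' ∧ Disjoint c c' ∧ NonSep c ∧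
        NonSep c' ∧ BoundsDisc (H p) c ∧ ∀ q : Fin 3, q ≠ p → BoundsDisc (H q) c') :=
  Iff.rfl

/-- `IsReducible` fully inlined (by `rfl`), in the `let`-bound shape of route statements.
[cite: ArandaZupan2025, §2 (p. 6)] -/
theorem isReducible_iff (S : Fin 3 → Set X) :
    IsReducible S ↔
      (let F : Set X := ⋂ l, S l
      let H : Fin 3 → Set X := fun p => ⋂ (l : Fin 3) (_ : l ≠ p), S l
      let IsCurve : Set X → Prop := fun c => c ⊆ F ∧
        ∃ γ : 𝕊 1 → X, Manifold.IsSmoothEmbedding (𝓡 1) (𝓡 4) ∞ γ ∧ range γ = c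
      let BoundsDisc : Set X → Set X → Prop := fun A c =>
        ∃ d : 𝔻 2 → X, Manifold.IsSmoothEmbedding (𝓡∂ 2) (𝓡 4) ∞ d ∧ range d ⊆ A ∧
          d '' (𝓡∂ 2).boundary (𝔻 2) = c ∧ range d ∩ F = c
      ∃ δ : Set X, IsCurve δ ∧
        ¬ (∃ e : 𝔻 2 → X, Manifold.IsSmoothEmbedding (𝓡∂ 2) (𝓡 4) ∞ e ∧ range e ⊆ F ∧
            e '' (𝓡∂ 2).boundary (𝔻 2) = δ) ∧
        ∀ q : Fin 3, BoundsDisc (H q) δ) :=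
  Iff.rfl

/-- The two curves of a weak reduction are curves on the central surface. [folklore] -/
theorem IsWeaklyReducible.exists_isCurve {S : Fin 3 → Set X} (h : IsWeaklyReducible S) :
    ∃ c c' : Set X, IsCurve S c ∧ IsCurve S c' ∧ Disjoint c c' := by
  obtain ⟨-, c, c', hc, hc', hd, -⟩ := h
  exact ⟨c, c', hc, hc', hd⟩

/-- A curve lies on the central surface. [folklore] -/
theorem IsCurve.subset_centralSurfaceSet {S : Fin 3 → Set X} {c : Set X} (h : IsCurve S c) :
    c ⊆ centralSurfaceSet S :=
  h.1

end Trisection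

/-! ### Aranda–Zupan 2025, Thm. 1.3: the homotopy-sphere corollary (named fact) -/

/-- **Aranda–Zupan 2025, Thm. 1.3, homotopy-sphere corollary (named fact): a trisected homotopy
4-sphere with a WEAKLY REDUCIBLE genus-three trisection is `S⁴`.**  Let `X` be a closed,
connected, oriented smooth 4-manifold with a `(3; k₀, k₁, k₂)`-trisection
(`Literature.Topology.FourManifolds.IsGKTrisection X 3 k S`) which is weakly reducible
(`Trisection.IsWeaklyReducible S`: disjoint non-separating curves `c`, `c′` on the central
surface, `c` compressing in one handlebody of the spine, `c′` in the other two).  Printed: "either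
`T` is reducible, or `T` contains a five-chain. In particular, `X` is diffeomorphic to a spun
lens space `S_p` or its sibling `S′_p`, `S⁴`, or a connected sum of copies of `±ℂP²`, `S¹ × S³`,
and `S² × S²`" — and in this list the only homotopy 4-sphere is `S⁴`: `S_p`, `S′_p` are the two
surgeries on a loop of class `p ∈ ℤ = π₁(S¹ × S³)` (§2, p. 7), so `π₁ = ℤ/p` (`ℤ` for `p = 0`),
and for `p = ±1` both siblings are `S⁴` (Pao: the siblings are diffeomorphic for odd `p`; `S_{±1}`
is the spin of `S³`); a sum with an `S¹ × S³` summand has `π₁ ≠ 1`, one with a `±ℂP²` or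
`S² × S²` summand has `H₂ ≠ 0`.  Hence if `X ≃ₕ S⁴` then `X ≅ S⁴`.  Conclusion weakened to
"`≅ S⁴`" (cf. `Literature.Barriers.SmoothPoincare4.mz_genus_le_two_homotopySphere_gk` for genus
`≤ 2`, same shape); the disjointness of `c`, `c′` (printed on p. 2, implicit on p. 6) is part of the
hypothesis.  Users take `(h : arandaZupan_genus_three_weaklyReducible_homotopySphere_gk)`.
[cite: ArandaZupan2025, Thm. 1.3 (p. 2); definition of weakly reducible §2 (p. 6)] -/
def arandaZupan_genus_three_weaklyReducible_homotopySphere_gk : Prop :=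
  ∀ (X : Type u) [TopologicalSpace X] [T2Space X] [SecondCountableTopology X]
    [ChartedSpace (𝔼 4) X] [IsManifold (𝓡 4) ∞ X] [CompactSpace X] [ConnectedSpace X]
    (_ : SmoothOrientation (𝓡 4) X) (k : Fin 3 → ℕ) (S : Fin 3 → Set X),
    IsGKTrisection X 3 k S → Trisection.IsWeaklyReducible S → X ≃ₕ 𝕊 4 →
      Nonempty (X ≃ₘ⟮𝓡 4, 𝓡 4⟯ (𝕊 4))

end Literature.Topology.FourManifolds

end
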